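/-
LEAD seat `ym-line-cbag-p1` (prover-ym-line-cbag-p1-g26-0), LINE 8 `EguchiKawaiDirectionLadder` (closed·proved): barrier-ledger
polish `--supports stmt-QuantumFields-27724` — the two sides of the Eguchi–Kawai centre-symmetry transition put together.
-/
import Literature.Barriers.QuantumFields.EguchiKawaiBreakdownStrongCoupling
import Summits.QuantumFields.YangMills.Theorems.EguchiKawaiDirectionLadderBreakdownCorollaries
import HarnessLib

/-!
# Route `EguchiKawaiDirectionLadder`: the centre-symmetry TRANSITION of the naive Eguchi–Kawai model is a theorem

Two unconditional facts about the single-site Eguchi–Kawai model (`U(N)^d`, reduced Wilson action, inverse 't Hooft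
coupling `b`) are now in the tree:

* STRONG COUPLING (`Literature.Barriers.QuantumFields.ekOpenLinesVanish_of_strongCoupling`, this unit's generation g26):
  for `8|b|(d − 1) < 1` the open-line order parameter `⟨|(1/N) tr U_μ|²⟩_EK` is `≤ 4/(N²(1 − 8|b|(d−1)))` for `N ≥ 2`,
  hence tends to `0` — the standing hypothesis `EKOpenLinesVanish d b` of the reduction HOLDS (conditional Bakry–Émery on
  one `SU(N)` link + `ℤ_N` invariance of the conditional law; no cluster expansion);
* WEAK COUPLING (`EguchiKawaiBreakdown_holds`, LINE 8, g24): for `d ≥ 3` there is `b₀ ≥ 0` such that for every `b > b₀`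
  the order parameter does NOT tend to zero in some direction.

This file records the consequences one states in words as "the `U(1)^d` / `ℤ_N^d` centre symmetry of the naive
Eguchi–Kawai model is unbroken at strong coupling and broken at weak coupling, so the model has a phase transition in
`b` for every `d ≥ 3`" (Makeenko §14.3, PDF p. 246; Bhanot–Heller–Neuberger 1982):

* `ek_centreSymmetry_transition` : for `d ≥ 3` there are `0 < b₁ ≤ b₀` with `EKOpenLinesVanish d b` for all `|b| < b₁` and
  `¬ EKOpenLinesVanish d b` for all `b > b₀`;
* `ek_centreSymmetry_transition_four` : the case `d = 4`;
* `ekOpenLinesVanish_iff_not_large` flavour is NOT claimed: nothing is said about `b₁ ≤ |b| ≤ b₀` (a single sharp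
  transition point is not asserted in print either).

HONEST FRAMING.  Barrier-ledger facts about the single-site model; the Yang–Mills mass gap / the summit `YangMills`
is not proved or advanced by any of this.
-/

namespace Summit.QuantumFields.YangMills.Theorems.EguchiKawaiDirectionLadder

open Literature.Barriers.QuantumFields

/-- **The Eguchi–Kawai centre-symmetry transition exists for every `d ≥ 3`**: there are couplings `0 < b₁ ≤ b₀` such
that the open-line order parameter vanishes as `N → ∞` in every direction for all `|b| < b₁` (strong coupling) and fails to
vanish in some direction for all `b > b₀` (weak coupling).  (`b₁ ≤ b₀` is forced: on `(b₀, b₁)` both would hold.) -/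
theorem ek_centreSymmetry_transition {d : ℕ} (hd : 3 ≤ d) :
    ∃ b₁ b₀ : ℝ, 0 < b₁ ∧ b₁ ≤ b₀ ∧ (∀ b : ℝ, |b| < b₁ → EKOpenLinesVanish d b) ∧
      (∀ b : ℝ, b₀ < b → ¬ EKOpenLinesVanish d b) := by
  obtain ⟨b₁, hb₁, hvan⟩ := ekOpenLinesVanish_strongCoupling d
  obtain ⟨b₀, hb₀, hbr⟩ := not_ekOpenLinesVanish_weakCoupling hd
  refine ⟨b₁, b₀, hb₁, ?_, hvan, hbr⟩
  by_contra hlt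
  push Not at hlt
  -- the midpoint of `(b₀, b₁)` is both strongly and weakly coupled
  have h1 : b₀ < (b₀ + b₁) / 2 := by linarith
  have h2 : |(b₀ + b₁) / 2| < b₁ := by
    rw [abs_of_nonneg (by linarith)]; linarith
  exact hbr _ h1 (hvan _ h2)

/-- **The summit's dimension `d = 4`**: the naive Eguchi–Kawai model has a centre-symmetry transition in the inverse
't Hooft coupling — unbroken for `|b| < b₁`, broken for `b > b₀`, `0 < b₁ ≤ b₀`. -/
theorem ek_centreSymmetry_transition_four :
    ∃ b₁ b₀ : ℝ, 0 < b₁ ∧ b₁ ≤ b₀ ∧ (∀ b : ℝ, |b| < b₁ → EKOpenLinesVanish 4 b) ∧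
      (∀ b : ℝ, b₀ < b → ¬ EKOpenLinesVanish 4 b) :=
  ek_centreSymmetry_transition (by norm_num)

/-- **Explicit strong-coupling window in `d = 4`**: the reduction hypothesis holds for `|b| < 1/24`. -/
theorem ekOpenLinesVanish_four_of_abs_lt {b : ℝ} (hb : |b| < 1 / 24) : EKOpenLinesVanish 4 b :=
  ekOpenLinesVanish_of_strongCoupling (d := 4) (by push_cast; linarith)

/-- **The weak-coupling threshold is at least the strong-coupling window**: for `d ≥ 3`, every `b₀` as in
`EguchiKawaiBreakdown` satisfies `b₀ ≥ 1/(8(d−1))` — breaking cannot start inside the proved symmetric window. -/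
theorem ek_breaking_threshold_ge {d : ℕ} (hd : 3 ≤ d) {b₀ : ℝ}
    (hbr : ∀ b : ℝ, b₀ < b → ¬ EKOpenLinesVanish d b) : 1 / (8 * ((d : ℝ) - 1)) ≤ b₀ := by
  by_contra hlt
  push Not at hlt
  have hd1 : (0 : ℝ) < (d : ℝ) - 1 := by
    have : (3 : ℝ) ≤ d := by exact_mod_cast hd
    linarith
  -- a coupling strictly between `b₀` and `1/(8(d-1))`, made non-negative
  set b : ℝ := (max b₀ 0 + 1 / (8 * ((d : ℝ) - 1))) / 2 with hbdef
  have hpos : 0 < 1 / (8 * ((d : ℝ) - 1)) := by positivity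
  have hmax : max b₀ 0 < 1 / (8 * ((d : ℝ) - 1)) := max_lt hlt hpos
  have hb0 : b₀ < b := by
    have := le_max_left b₀ 0
    rw [hbdef]; linarith
  have hbnn : 0 ≤ b := by
    have := le_max_right b₀ 0
    rw [hbdef]; linarith
  have hblt : b < 1 / (8 * ((d : ℝ) - 1)) := by rw [hbdef]; linarith
  have hwin : 8 * |b| * ((d : ℝ) - 1) < 1 := by
    rw [abs_of_nonneg hbnn]
    have h8 : (0 : ℝ) < 8 * ((d : ℝ) - 1) := by positivity
    have := (lt_div_iff₀ h8).1 hblt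
    linarith
  exact hbr b hb0 (ekOpenLinesVanish_of_strongCoupling hwin)

end Summit.QuantumFields.YangMills.Theorems.EguchiKawaiDirectionLadder
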